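import Literature.Analysis.FluidPDE.TaoQuantitativeLPPointwise
import Literature.Analysis.FunctionSpaces.LittlewoodPaleyPartitionProofs
import Literature.Analysis.FluidPDE.BesovMildWeak
import Literature.Analysis.FunctionSpaces.SobolevDomainProofs
import HarnessLib

/-!
# Lipschitz blocks and quasi-orthogonality of the Littlewood–Paley blocks at function level

Analysis/FluidPDE support file (serves the discharge of the named fact
`Literature.Analysis.FluidPDE.cheskidov_dai_occupation_regular`, Cheskidov–Dai, arXiv:1507.06611 =
Proc. Edinburgh Math. Soc. (2025), Thm. 1.1). The proof of that criterion (§3.1 of the paper) runs the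
`H^s` energy estimate of Cheskidov–Shvydkoy 2010 with Bony's decomposition in the COMMUTATOR form
`Δ_q(u_{≤p-2}·∇u_p) = [Δ_q, u_{≤p-2}·∇]u_p + u_{≤p-2}·∇Δ_q u_p`, so that every derivative falling on a
high block is compensated. Beside the commutator estimate (`FunctionSpaces/LittlewoodPaleyCommutator.lean`)
this needs the following function-level facts about the real blocks `Δ̇_j = blockFn j` of fields
`v : E → ℝ^ι`, all **proved** here from the tree's distribution-level Littlewood–Paley theory through the
dictionary `IsDistributionOf`:

* `exists_lipschitz_blockFn_le` — Bernstein in `L^∞` for derivatives of blocks (tree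
  `exists_eLpNorm_top_fderiv_blockFn_le`, `TaoQuantitativeLPPointwise.lean`:
  `‖∂_m Δ̇_j v‖_∞ ≤ C 2^j ‖m‖ ‖Δ̇_j v‖_∞`) makes the blocks of a smooth `L²` field Lipschitz with constant
  `L_l(v) = ∑_i ‖∂_i Δ̇_l v‖_∞ ≤ d C 2^l ‖Δ̇_l v‖_∞` (mean value inequality) — the form in which the
  LOW-frequency factor enters the commutator estimate;
* `blockFn_blockFn_ae_eq_zero`, `blockFn_blockFn_eq_zero`, `blockFn_sum_window_eq` — quasi-orthogonality
  at function level: `Δ̇_j Δ̇_l v = 0` for `|j - l| ≥ 2` (tree `lpBlock_lpBlock_eq_zero_of_lt_holds`) and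
  `Δ̇_j (∑_{l=j-2}^{j+2} Δ̇_l v) = Δ̇_j v` for smooth `L²` fields (the paper's "`∑_{|q-p|≤2} Δ_q u_p = u_q`",
  through the `L²` convergence of the Littlewood–Paley series, tree `tendsto_eLpNorm_sub_sum_blockFn`).

## References

* A. Cheskidov, M. Dai, arXiv:1507.06611 = Proc. Edinburgh Math. Soc. (2025), §3.1. [CheskidovDai2015]
* H. Bahouri, J.-Y. Chemin, R. Danchin, *Fourier Analysis and Nonlinear PDE*, Springer 2011, Lemma 2.1,
  (2.4). [BahouriCheminDanchin2011]
-/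

noncomputable section

open MeasureTheory Filter Function Set
open scoped ENNReal NNReal RealInnerProductSpace Topology SchwartzMap
open Literature.Analysis.FunctionSpaces

namespace Literature.Analysis.FluidPDE


/-! ## Quasi-orthogonality of the blocks at function level -/

section QuasiOrthogonal

variable {ι : Type*} [Fintype ι]
variable {E : Type*} [NormedAddCommGroup E] [InnerProductSpace ℝ E] [FiniteDimensional ℝ E]
  [MeasurableSpace E] [BorelSpace E]

/-- **Quasi-orthogonality of the blocks of an `L²` field, a.e. form** (BCD (2.4): `Δ̇_j Δ̇_l = 0` for
`|j - l| ≥ 2`, tree `lpBlock_lpBlock_eq_zero_of_lt_holds`, read through the dictionary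
`IsDistributionOf`): `Δ̇_j (Δ̇_l v) = 0` a.e. for `v ∈ L²(E; ℝ^ι)`. [cite: BahouriCheminDanchin2011, (2.4)] -/
theorem blockFn_blockFn_ae_eq_zero {j l : ℤ} (h : 1 < |j - l|) {v : E → EuclideanSpace ℝ ι}
    (hv : MemLp v 2 volume) :
    FunctionSpaces.blockFn j (FunctionSpaces.blockFn l v) =ᵐ[volume] (0 : E → EuclideanSpace ℝ ι) := by
  haveI : Fact (1 ≤ (2 : ℝ≥0∞)) := ⟨one_le_two⟩
  have hV := isDistributionOf_toTemperedDistribution (ι := ι) hv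
  have hl := hV.blockFn hv l
  have hjl := hl.blockFn (memLp_blockFn l hv one_le_two) j
  rw [lpBlock_lpBlock_eq_zero_of_lt_holds h] at hjl
  exact hjl.ae_eq isDistributionOf_zero

/-- **Quasi-orthogonality, pointwise form** for fields with bounded derivatives (then all blocks are
continuous): `Δ̇_j (Δ̇_l v) = 0` for `|j - l| ≥ 2`. [cite: BahouriCheminDanchin2011, (2.4)] -/
theorem blockFn_blockFn_eq_zero {j l : ℤ} (h : 1 < |j - l|) {v : E → EuclideanSpace ℝ ι}
    (hv : HasBoundedDerivs v) (hv2 : MemLp v 2 volume) :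
    FunctionSpaces.blockFn j (FunctionSpaces.blockFn l v) = 0 := by
  have hc : Continuous (FunctionSpaces.blockFn j (FunctionSpaces.blockFn l v)) := ((hv.blockFn l).blockFn j).continuous
  exact (Continuous.ae_eq_iff_eq volume hc continuous_const).1 (blockFn_blockFn_ae_eq_zero h hv2)

/-- **The block of the near-diagonal window is the block** (Cheskidov–Dai §3.1: "we used
`∑_{|q-p|≤2} Δ_q u_p = u_q`"): for a smooth `L²` field `v` on a nontrivial space,
`Δ̇_j (∑_{l = j-2}^{j+2} Δ̇_l v) = Δ̇_j v` — the Littlewood–Paley series of `v` converges in `L²`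
(tree `tendsto_eLpNorm_sub_sum_blockFn`), `Δ̇_j` is `L²`-bounded, and the far blocks are killed by
quasi-orthogonality. [cite: BahouriCheminDanchin2011, (2.4)] -/
theorem blockFn_sum_window_eq [Nontrivial E] (j : ℤ) {v : E → EuclideanSpace ℝ ι} (hv : IsSmoothL2Field v) :
    FunctionSpaces.blockFn j (∑ l ∈ Finset.Icc (j - 2) (j + 2), FunctionSpaces.blockFn l v) =
      FunctionSpaces.blockFn j v := by
  haveI : Fact (1 ≤ (2 : ℝ≥0∞)) := ⟨one_le_two⟩
  have hv2 : MemLp v 2 volume := hv.memLp_two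
  have hbl : ∀ l, MemLp (FunctionSpaces.blockFn l v) 2 volume := fun l => memLp_blockFn l hv2 one_le_two
  obtain ⟨C₂, hC₂⟩ := exists_eLpNorm_blockFn_two_le (E := E) (ι := ι)
  set S : ℕ → E → EuclideanSpace ℝ ι := fun N => ∑ l ∈ Finset.Icc (-(N : ℤ)) N, FunctionSpaces.blockFn l v with hS
  set W : E → EuclideanSpace ℝ ι := ∑ l ∈ Finset.Icc (j - 2) (j + 2), FunctionSpaces.blockFn l v with hW
  -- the terms far from `j` vanish
  have hzero : ∀ l, l ∉ Finset.Icc (j - 1) (j + 1) → FunctionSpaces.blockFn j (FunctionSpaces.blockFn l v) = 0 := by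
    intro l hl
    refine blockFn_blockFn_eq_zero ?_ hv.toHasBoundedDerivs hv2
    simp only [Finset.mem_Icc, not_and_or, not_le] at hl
    rcases hl with hl | hl
    · rw [abs_of_nonneg (by omega)]; omega
    · rw [abs_of_nonpos (by omega)]; omega
  have hcore : ∀ s : Finset ℤ, Finset.Icc (j - 1) (j + 1) ⊆ s →
      FunctionSpaces.blockFn j (∑ l ∈ s, FunctionSpaces.blockFn l v) =
        ∑ l ∈ Finset.Icc (j - 1) (j + 1), FunctionSpaces.blockFn j (FunctionSpaces.blockFn l v) := by
    intro s hs
    rw [blockFn_sum j s fun l _ => hbl l]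
    exact (Finset.sum_subset hs fun l _ hl => hzero l hl).symm
  have hWeq : FunctionSpaces.blockFn j W =
      ∑ l ∈ Finset.Icc (j - 1) (j + 1), FunctionSpaces.blockFn j (FunctionSpaces.blockFn l v) :=
    hcore _ (Finset.Icc_subset_Icc (by omega) (by omega))
  have hSeq : ∀ N : ℕ, j.natAbs + 1 ≤ N → FunctionSpaces.blockFn j (S N) =
      ∑ l ∈ Finset.Icc (j - 1) (j + 1), FunctionSpaces.blockFn j (FunctionSpaces.blockFn l v) := by
    intro N hN
    refine hcore _ (Finset.Icc_subset_Icc ?_ ?_) <;> omega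
  -- `Δ̇_j S_N → Δ̇_j v` in `L²`
  have hSmem : ∀ N, MemLp (S N) 2 volume := fun N => memLp_finsetSum' _ fun l _ => hbl l
  have hlim : Tendsto (fun N : ℕ => eLpNorm (FunctionSpaces.blockFn j v - FunctionSpaces.blockFn j (S N)) 2 volume)
      atTop (𝓝 0) := by
    have h0 := tendsto_eLpNorm_sub_sum_blockFn (E := E) (ι := ι) hv2
    have hle : ∀ N, eLpNorm (FunctionSpaces.blockFn j v - FunctionSpaces.blockFn j (S N)) 2 volume ≤
        C₂ * eLpNorm (v - S N) 2 volume := by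
      intro N
      rw [← blockFn_sub j hv2 (hSmem N)]
      exact hC₂ j _ (hv2.sub (hSmem N))
    have h1 : Tendsto (fun N : ℕ => (C₂ : ℝ≥0∞) * eLpNorm (v - S N) 2 volume) atTop (𝓝 ((C₂ : ℝ≥0∞) * 0)) :=
      ENNReal.Tendsto.const_mul h0 (Or.inr ENNReal.coe_ne_top)
    rw [mul_zero] at h1
    exact tendsto_of_tendsto_of_tendsto_of_le_of_le tendsto_const_nhds h1 (fun _ => bot_le) hle
  -- the sequence is eventually the constant `‖Δ̇_j v - Δ̇_j W‖₂`, which therefore vanishes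
  have hconst : eLpNorm (FunctionSpaces.blockFn j v - FunctionSpaces.blockFn j W) 2 volume = 0 := by
    refine le_antisymm (ge_of_tendsto hlim ?_) bot_le
    filter_upwards [eventually_ge_atTop (j.natAbs + 1)] with N hN
    rw [hSeq N hN, ← hWeq]
  have hae : FunctionSpaces.blockFn j v =ᵐ[volume] FunctionSpaces.blockFn j W := by
    have h := (eLpNorm_eq_zero_iff ((hbl j).sub (memLp_blockFn j (memLp_finsetSum' _ fun l _ => hbl l)
      one_le_two)).1 two_ne_zero).1 hconst
    exact (sub_ae_eq_zero _ _).1 h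
  have hWs : HasBoundedDerivs W := by
    rw [hW]
    have : ∀ s : Finset ℤ, HasBoundedDerivs (∑ l ∈ s, FunctionSpaces.blockFn l v) := by
      intro s
      classical
      induction s using Finset.induction_on with
      | empty => simpa using HasBoundedDerivs.zero
      | insert a s ha ih => rw [Finset.sum_insert ha]; exact (hv.toHasBoundedDerivs.blockFn a).add ih
    exact this _
  exact ((Continuous.ae_eq_iff_eq volume (hv.toHasBoundedDerivs.blockFn j).continuous
    (hWs.blockFn j).continuous).1 hae).symm

end QuasiOrthogonal

/-! ## Lipschitz constants of fields from the sup norms of their partial derivatives -/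

section Lipschitz

variable {E : Type*} [NormedAddCommGroup E] [InnerProductSpace ℝ E] [FiniteDimensional ℝ E]
  [MeasurableSpace E] [BorelSpace E]
variable {E' : Type*} [NormedAddCommGroup E'] [NormedSpace ℝ E']

omit [MeasurableSpace E] [BorelSpace E] [FiniteDimensional ℝ E] in
/-- The operator norm of a linear map is at most the sum of the norms of the images of an
orthonormal basis: `‖T‖ ≤ ∑_i ‖T b_i‖` (`x = ∑_i ⟪b_i, x⟫ b_i`, `|⟪b_i, x⟫| ≤ ‖x‖`). [folklore] -/
private theorem opNorm_le_sum_norm_apply_basis_aux {κ : Type*} [Fintype κ] (b : OrthonormalBasis κ ℝ E)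
    (T : E →L[ℝ] E') : ‖T‖ ≤ ∑ i, ‖T (b i)‖ := by
  refine ContinuousLinearMap.opNorm_le_bound _ (Finset.sum_nonneg fun i _ => norm_nonneg _) fun x => ?_
  conv_lhs => rw [← b.sum_repr' x]
  rw [map_sum, Finset.sum_mul]
  refine (norm_sum_le _ _).trans (Finset.sum_le_sum fun i _ => ?_)
  rw [map_smul, norm_smul]
  calc ‖⟪b i, x⟫‖ * ‖T (b i)‖ ≤ ‖x‖ * ‖T (b i)‖ := by
        gcongr
        refine (abs_real_inner_le_norm _ _).trans ?_
        rw [b.orthonormal.1 i, one_mul]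
    _ = ‖T (b i)‖ * ‖x‖ := mul_comm _ _

/-- **A field with bounded continuous derivative is Lipschitz with constant the sum of the sup norms
of its partial derivatives**: `‖w x - w y‖ ≤ (∑_i ‖∂_{b_i} w‖_{L^∞}) ‖x - y‖` (mean value inequality;
a continuous function is everywhere bounded by its `L^∞` norm, tree
`FunctionSpaces.enorm_le_eLpNorm_top_of_continuous`). [folklore] -/
private theorem norm_sub_le_sum_eLpNorm_fderiv_mul {w : E → E'} (hw : HasBoundedDerivs w) (x y : E) :
    ‖w x - w y‖ ≤ (∑ i, (eLpNorm (fun z => fderiv ℝ w z (stdOrthonormalBasis ℝ E i)) ∞ volume).toReal) * ‖x - y‖ := by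
  set b := stdOrthonormalBasis ℝ E
  have hw1 : ContDiff ℝ 1 w := hw.contDiff_nat 1
  have hdi : ∀ i, HasBoundedDerivs (fun z => fderiv ℝ w z (b i)) := fun i => hw.fderiv_apply (b i)
  have htop : ∀ i, eLpNorm (fun z => fderiv ℝ w z (b i)) ∞ volume ≠ ∞ := fun i =>
    (memLp_top_of_hasBoundedDerivs (hdi i)).eLpNorm_ne_top
  have hbound : ∀ z, ‖fderiv ℝ w z‖ ≤ ∑ i, (eLpNorm (fun z => fderiv ℝ w z (b i)) ∞ volume).toReal := by
    intro z
    refine (opNorm_le_sum_norm_apply_basis_aux b (fderiv ℝ w z)).trans (Finset.sum_le_sum fun i _ => ?_)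
    have h := FunctionSpaces.enorm_le_eLpNorm_top_of_continuous (volume : Measure E) (hdi i).continuous z
    rw [← toReal_enorm]
    exact ENNReal.toReal_mono (htop i) h
  have := Convex.norm_image_sub_le_of_norm_fderiv_le (f := w) (s := Set.univ)
    (fun z _ => (hw1.differentiable one_ne_zero z)) (fun z _ => hbound z) convex_univ (Set.mem_univ y) (Set.mem_univ x)
  exact this

/-- The Lipschitz constant of the previous lemma, in `ℝ≥0∞`: `ofReal (∑_i ‖∂_{b_i} w‖_∞.toReal) = ∑_i ‖∂_{b_i} w‖_∞`
for a field with bounded derivatives. [folklore] -/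
private theorem ofReal_sum_toReal_eLpNorm_fderiv {w : E → E'} (hw : HasBoundedDerivs w) :
    ENNReal.ofReal (∑ i, (eLpNorm (fun z => fderiv ℝ w z (stdOrthonormalBasis ℝ E i)) ∞ volume).toReal) =
      ∑ i, eLpNorm (fun z => fderiv ℝ w z (stdOrthonormalBasis ℝ E i)) ∞ volume := by
  have htop : ∀ i, eLpNorm (fun z => fderiv ℝ w z (stdOrthonormalBasis ℝ E i)) ∞ volume ≠ ∞ := fun i =>
    (memLp_top_of_hasBoundedDerivs (hw.fderiv_apply _)).eLpNorm_ne_top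
  rw [← ENNReal.toReal_sum fun i _ => htop i, ENNReal.ofReal_toReal (ENNReal.sum_ne_top.2 fun i _ => htop i)]

variable {ι : Type*} [Fintype ι]

/-- **Bernstein makes the blocks Lipschitz with constant `≲ 2^l ‖Δ̇_l v‖_∞`** (BCD Lemma 2.1: the derivatives
of a spectrally localised function cost a factor `2^l` in every `L^p`, here `p = ∞`): there is `C` such that
for every smooth `L²` field `v` and every `l`, the real number
`L_l(v) = ∑_i ‖∂_{b_i} Δ̇_l v‖_{L^∞}` is a Lipschitz constant of `Δ̇_l v`,
`‖Δ̇_l v (x) - Δ̇_l v (y)‖ ≤ L_l(v) ‖x - y‖`, and `L_l(v) ≤ d · C · 2^l · ‖Δ̇_l v‖_{L^∞}` (`d = dim E`). This is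
the form in which the low-frequency factor enters the commutator estimate of
`LittlewoodPaleyCommutator.lean`. [cite: BahouriCheminDanchin2011, Lemma 2.1] -/
theorem exists_lipschitz_blockFn_le :
    ∃ C : ℝ≥0, ∀ (l : ℤ) (v : E → EuclideanSpace ℝ ι), IsSmoothL2Field v →
      (∀ x y, ‖FunctionSpaces.blockFn l v x - FunctionSpaces.blockFn l v y‖ ≤
        (∑ i, (eLpNorm (fun z => fderiv ℝ (FunctionSpaces.blockFn l v) z (stdOrthonormalBasis ℝ E i)) ∞ volume).toReal) *
          ‖x - y‖) ∧
      ENNReal.ofReal (∑ i, (eLpNorm (fun z => fderiv ℝ (FunctionSpaces.blockFn l v) z (stdOrthonormalBasis ℝ E i))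
          ∞ volume).toReal) ≤
        Fintype.card (Fin (Module.finrank ℝ E)) * (C * ENNReal.ofReal ((2 : ℝ) ^ l) *
          eLpNorm (FunctionSpaces.blockFn l v) ∞ volume) := by
  obtain ⟨C, hC⟩ := exists_eLpNorm_top_fderiv_blockFn_le (E := E) (ι := ι)
  refine ⟨C, fun l v hv => ⟨fun x y => norm_sub_le_sum_eLpNorm_fderiv_mul (hv.toHasBoundedDerivs.blockFn l) x y, ?_⟩⟩
  rw [ofReal_sum_toReal_eLpNorm_fderiv (hv.toHasBoundedDerivs.blockFn l)]
  calc ∑ i, eLpNorm (fun z => fderiv ℝ (FunctionSpaces.blockFn l v) z (stdOrthonormalBasis ℝ E i)) ∞ volume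
      ≤ ∑ _i : Fin (Module.finrank ℝ E), (C : ℝ≥0∞) * ENNReal.ofReal ((2 : ℝ) ^ l) *
          eLpNorm (FunctionSpaces.blockFn l v) ∞ volume := by
        refine Finset.sum_le_sum fun i _ => ?_
        have h := hC (stdOrthonormalBasis ℝ E i) l v (IsC1L2Field.of_isSmoothL2Field hv)
        rwa [(stdOrthonormalBasis ℝ E).orthonormal.1 i, mul_one] at h
    _ = Fintype.card (Fin (Module.finrank ℝ E)) * (C * ENNReal.ofReal ((2 : ℝ) ^ l) *
          eLpNorm (FunctionSpaces.blockFn l v) ∞ volume) := by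
        rw [Finset.sum_const, Finset.card_univ, nsmul_eq_mul]

end Lipschitz

end Literature.Analysis.FluidPDE

end
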